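import Summits.CriticalPhenomena.PercolationContinuityZ3.Theorems.PercNearOneGluingNoHeavyQuantIndepBlobTwoLevelRow
import HarnessLib

/-!
# QUANT lane R8, FAR for independent blobs (VIII): the size row at ODD total — `2y ≤ Σ a + 1`, all gates `≥ 1/2` ⟹ `P(W ≥ y) ≥ least gate`,
# and the same with one extra blob of ARBITRARY gate

builds on p205010 (kernel theorem, internal audit signed; external expert review pending)

Support file (`--supports stmt-CriticalPhenomena-4575`), QUANT lane lead (gen 15); memo
`run/shared/lean/prim/quant/prim-quant-lead-g15/LEAD-NOTES-G15.md` N27–N29.  Theorems only, no definitions, no sorries, standard axioms.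

The kernel's size row `IndepBlob.tail_ge_gate_of_two_mul_le_size` (`…QuantTwoPointHubSliver`) asks `2y ≤ Σ a`.  For INTEGER sizes one unit less suffices:
apply p1's two-threshold transport `IndepBlob.gapRow_of_half_le_gate` with the HALF-INTEGER thresholds `λ = η = y − 1/2` (`λ + η = 2y − 1 ≤ Σ a`); since
`a(W)` is an integer, `{a(W) < y − 1/2} = {a(W) ≤ y − 1}` and `{a(V) ≥ y − 1/2} = {a(V) ≥ y}`, so `g·P(W ≤ y−1) ≤ (1 − g)·P(W ≥ y)`, i.e. `P(W ≥ y) ≥ g`.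
(Equivalently: a light set `W` with `a(W) ≤ y − 1` has complement weight `≥ Σ a − y + 1 ≥ y`, which is all the Hall–antipodal-Harris injection needs, and the injected
superset is automatically strict.)  Equality: one blob of size `2y − 1`; `2y − 1` units at gate `1/2`; sizes `(2, 2, 1)` at `1/2` with `y = 3`.

* `Quant.IndepBlob.tail_ge_gate_of_two_mul_le_size_succ` — gates `p y₀ ≤ p k ≤ 1`, `1/2 ≤ p y₀`, integer sizes, `2y ≤ Σ a + 1` ⟹ `p y₀ ≤ P(y ≤ W)`.
* `Quant.IndepBlob.sizeRow_with_extra_blob` — the same floor survives ONE extra independent blob `x₀` of ARBITRARY gate in `[0,1]` (in particular a light one):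
  if the other blobs have gates `≥ p y₀ ≥ 1/2` and sizes totalling `≥ 2j + 1` then `p y₀ ≤ P(j+1 ≤ W)` (condition on `x₀` by `tail_split`; both branches are `≥` the row for the
  others).  This supersedes the hypothesis `1/2 ≤ p x₀` of `companion_sizeRow_of_half_le_gate` (`…QuantIndepBlobCompanionRow`) and settles Conjecture DIB* (census-2 gen 49;
  README V185) in the case 'floor `≥ 1/2`, heavy total `≥ 2j+1`, one light blob' WITHOUT using the light credit; with `IndepBlob.dibStar_of_le_half` (`…QuantIndepBlobDiscountLow`,
  floor `≤ 1/2`) the only open case of DIB* with one light blob is 'floor `> 1/2`, heavy total `≤ 2j`'.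
Exact second check (lead g15, `prim-quant-lead-g15/explore/oddrow.py`): 43 671 instances with `2y ≤ Σ a + 1`, 0 failures, 2 126 equalities.  [this work]
-/

namespace Summit.CriticalPhenomena.PercolationContinuityZ3.Theorems

namespace Quant

namespace IndepBlob

open Finset

variable {κ : Type*} [Fintype κ] [DecidableEq κ]

/-- **Size row at odd total.**  Gates `0 ≤ p k ≤ 1` with a least reliable blob `y₀` (`p y₀ ≤ p k`, `1/2 ≤ p y₀`), INTEGER sizes `a k`, and a level `y` with
`2y ≤ Σ_k a k + 1`.  Then `p y₀ ≤ P(W ≥ y) = Σ_{s : y ≤ a(s)} w(s)`.  (The gap row with thresholds `y − 1/2`, `y − 1/2`.) [this work] -/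
theorem tail_ge_gate_of_two_mul_le_size_succ (p : κ → ℝ) (a : κ → ℕ) (hp0 : ∀ k, 0 ≤ p k) (hp1 : ∀ k, p k ≤ 1)
    (y₀ : κ) (hy₀ : ∀ k, p y₀ ≤ p k) (hhalf : 1 / 2 ≤ p y₀) (y : ℕ) (hT : 2 * y ≤ ∑ k, a k + 1) :
    p y₀ ≤ ∑ s ∈ (Finset.univ : Finset (Finset κ)).filter (fun s => y ≤ ∑ k ∈ s, a k), (∏ k, if k ∈ s then p k else 1 - p k) := by
  have hw0 : ∀ s : Finset κ, 0 ≤ (∏ k, if k ∈ s then p k else 1 - p k) := bernoulliWeight_nonneg hp0 hp1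
  have hrow := gapRow_of_half_le_gate p (fun k => (a k : ℝ)) (p y₀) hhalf (hp1 y₀) hy₀ hp1 (fun k => by positivity)
    ((y : ℝ) - 1 / 2) ((y : ℝ) - 1 / 2) le_rfl (by
      have : ((2 * y : ℕ) : ℝ) ≤ ((∑ k, a k + 1 : ℕ) : ℝ) := by exact_mod_cast hT
      push_cast at this
      linarith)
  -- identify the two events with integer thresholds
  have hH : ∑ V ∈ (Finset.univ : Finset (Finset κ)).filter (fun V => (y : ℝ) - 1 / 2 ≤ ∑ i ∈ V, (a i : ℝ)),
      (∏ k, if k ∈ V then p k else 1 - p k) =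
      ∑ s ∈ (Finset.univ : Finset (Finset κ)).filter (fun s => y ≤ ∑ k ∈ s, a k), (∏ k, if k ∈ s then p k else 1 - p k) := by
    refine Finset.sum_congr (Finset.filter_congr fun V _ => ?_) fun _ _ => rfl
    constructor
    · intro h
      have h' : (y : ℝ) - 1 / 2 ≤ ((∑ i ∈ V, a i : ℕ) : ℝ) := by push_cast; exact h
      have h2 : (y : ℝ) < ((∑ i ∈ V, a i : ℕ) : ℝ) + 1 := by linarith
      have h3 : y < (∑ i ∈ V, a i) + 1 := by exact_mod_cast h2
      omega
    · intro h
      have h' : ((y : ℕ) : ℝ) ≤ ((∑ i ∈ V, a i : ℕ) : ℝ) := by exact_mod_cast h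
      push_cast at h'
      linarith
  have hL : ∑ W ∈ (Finset.univ : Finset (Finset κ)).filter (fun W => ∑ i ∈ W, (a i : ℝ) < (y : ℝ) - 1 / 2),
      (∏ k, if k ∈ W then p k else 1 - p k) =
      ∑ s ∈ (Finset.univ : Finset (Finset κ)).filter (fun s => ¬ (y ≤ ∑ k ∈ s, a k)), (∏ k, if k ∈ s then p k else 1 - p k) := by
    refine Finset.sum_congr (Finset.filter_congr fun W _ => ?_) fun _ _ => rfl
    rw [not_le]
    constructor
    · intro h
      have h' : ((∑ i ∈ W, a i : ℕ) : ℝ) < (y : ℝ) - 1 / 2 := by push_cast; exact h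
      have h2 : ((∑ i ∈ W, a i : ℕ) : ℝ) < ((y : ℕ) : ℝ) := by linarith
      exact_mod_cast h2
    · intro h
      have h1 : (∑ i ∈ W, a i) + 1 ≤ y := h
      have h2 : (((∑ i ∈ W, a i) + 1 : ℕ) : ℝ) ≤ ((y : ℕ) : ℝ) := by exact_mod_cast h1
      push_cast at h2 ⊢
      linarith
  -- `P(W < y) + P(W ≥ y) = 1`
  have htot := sum_bernoulliWeight p
  have hc := Finset.sum_filter_add_sum_filter_not (Finset.univ : Finset (Finset κ))
    (fun s => y ≤ ∑ k ∈ s, a k) (fun s => (∏ k, if k ∈ s then p k else 1 - p k))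
  rw [htot] at hc
  rw [hH, hL] at hrow
  set T := ∑ s ∈ (Finset.univ : Finset (Finset κ)).filter (fun s => y ≤ ∑ k ∈ s, a k), (∏ k, if k ∈ s then p k else 1 - p k) with hTdef
  have hcomp : ∑ s ∈ (Finset.univ : Finset (Finset κ)).filter (fun s => ¬ (y ≤ ∑ k ∈ s, a k)),
      (∏ k, if k ∈ s then p k else 1 - p k) = 1 - T := by linarith
  rw [hcomp] at hrow
  nlinarith [hrow, hp1 y₀]

/-- **Size row with one extra blob of arbitrary gate.**  Blobs on `κ` with gates `0 ≤ p k ≤ 1` and INTEGER sizes; a distinguished blob `x₀` (any gate); a floor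
`y₀ ≠ x₀` with `1/2 ≤ p y₀ ≤ p k` for every `k ≠ x₀`; and a level `j` with `2j + 1 + a x₀ ≤ Σ_k a k` (the OTHER blobs total at least `2j + 1`).  Then
`p y₀ ≤ P(W ≥ j+1)`.  In Conjecture DIB* this is the case 'floor `≥ 1/2`, heavy total `≥ 2j+1`' with one light blob, and the light credit is not needed. [this work] -/
theorem sizeRow_with_extra_blob (p : κ → ℝ) (a : κ → ℕ) (hp0 : ∀ k, 0 ≤ p k) (hp1 : ∀ k, p k ≤ 1)
    (x₀ y₀ : κ) (hne : y₀ ≠ x₀) (hy₀ : ∀ k, k ≠ x₀ → p y₀ ≤ p k) (hhalf : 1 / 2 ≤ p y₀) (j : ℕ)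
    (hsize : 2 * j + 1 + a x₀ ≤ ∑ k, a k) :
    p y₀ ≤ ∑ s ∈ (Finset.univ : Finset (Finset κ)).filter (fun s => j + 1 ≤ ∑ k ∈ s, a k), (∏ k, if k ∈ s then p k else 1 - p k) := by
  set ι := {k : κ // k ≠ x₀} with hι
  have hw0' : ∀ W : Finset ι, 0 ≤ (∏ i : ι, if i ∈ W then p i else 1 - p i) :=
    bernoulliWeight_nonneg (fun i => hp0 i) (fun i => hp1 i)
  set A : ℝ := ∑ W ∈ (Finset.univ : Finset (Finset ι)).filter (fun W : Finset ι => j + 1 ≤ a x₀ + ∑ i ∈ W, a (i : κ)),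
      (∏ i : ι, if i ∈ W then p i else 1 - p i) with hA
  set U : ℝ := ∑ W ∈ (Finset.univ : Finset (Finset ι)).filter (fun W : Finset ι => j + 1 ≤ ∑ i ∈ W, a (i : κ)),
      (∏ i : ι, if i ∈ W then p i else 1 - p i) with hU
  rw [tail_split p a x₀ (j + 1)]
  show p y₀ ≤ p x₀ * A + (1 - p x₀) * U
  -- both branches dominate the row for the other blobs
  have hAU : U ≤ A := by
    refine Finset.sum_le_sum_of_subset_of_nonneg (fun W hW => ?_) fun W _ _ => hw0' W
    rw [Finset.mem_filter] at hW ⊢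
    exact ⟨hW.1, by omega⟩
  have hsize' : 2 * (j + 1) ≤ ∑ i : ι, a (i : κ) + 1 := by
    have hsplit : ∑ k, a k = a x₀ + ∑ i : ι, a (i : κ) := by
      rw [← Finset.add_sum_erase Finset.univ _ (Finset.mem_univ x₀),
        Finset.sum_subtype (Finset.univ.erase x₀) (p := fun k => k ≠ x₀) (fun k => by simp)]
    rw [hsplit] at hsize
    omega
  have hrow := tail_ge_gate_of_two_mul_le_size_succ (fun i : ι => p i) (fun i : ι => a (i : κ)) (fun i => hp0 i) (fun i => hp1 i)
    ⟨y₀, hne⟩ (fun i => hy₀ i i.2) hhalf (j + 1) hsize'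
  -- `hrow : p y₀ ≤ U`
  have hpx0 : 0 ≤ p x₀ := hp0 x₀
  have hpx1 : p x₀ ≤ 1 := hp1 x₀
  calc p y₀ ≤ U := hrow
    _ = p x₀ * U + (1 - p x₀) * U := by ring
    _ ≤ p x₀ * A + (1 - p x₀) * U := by nlinarith

end IndepBlob

end Quant

end Summit.CriticalPhenomena.PercolationContinuityZ3.Theorems
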